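import Summits.CriticalPhenomena.PercolationContinuityZ3.Theorems.PercNearOneGluingNoHeavyLowerTailSahiClassTCoreContainment
import Summits.CriticalPhenomena.PercolationContinuityZ3.Theorems.PercNearOneGluingNoHeavyLowerTailSahiClassTCoreJuntaFour
import HarnessLib

/-!
# `NoHeavyLowerTail` (crux stmt-CriticalPhenomena-4575), P2 — the open core, VI′: the hard residual core with **every member essential on `≥ 5` coordinates**

Support file (seat `prim-masterthm-p2`, gen 14; `--supports stmt-CriticalPhenomena-4575`).  No definition, no `sorry`; COMPUTATIONAL (it composes
`…SahiClassTCoreContainment` with P3's `native_decide` four-junta closure `sahiE_three_nonneg_of_card_esupp_le_four`, `…SahiClassTCoreJuntaFour`, whose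
certificates use `Lean.ofReduceBool`).

* `masterFamilyNonneg_three_of_hardResidualCore_five`, `…_iff_hardResidualCore_five`, `kahnConjecture_iff_hardResidualCore_five` — Kahn's Conjecture 5 ⟺ `C_3`
  on the hard residual core (`…SahiClassTCoreContainment`, conditions (1)–(6)) with (4) sharpened to: every member is essential on at least FIVE coordinates.
HONEST FRAMING: a reduction; `C_3` on this class remains OPEN. [this work]
-/

noncomputable section

open scoped Classical

namespace Summit.CriticalPhenomena.PercolationContinuityZ3.Theorems

namespace SahiClassTCube

open Finset Function
open Literature.Combinatorics.Sahi2008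
open Literature.Probability.LatticeModels (prodBernoulli)
open Literature.Probability.Percolation (DeterminedBy)
open Literature.Probability.Percolation.DecisionTree (ind)

/-- **Kahn's Conjecture 5 ⟸ `C_3` on the hard residual core with members essential on `≥ 5` coordinates** (computational: P3's four-junta certificates). [this work] -/
theorem masterFamilyNonneg_three_of_hardResidualCore_five
    (hres : ∀ (κ : Type) [Fintype κ] (p : κ → unitInterval) (U : Fin 3 → Set (Set κ)), (∀ j, IsUpperSet (U j)) →
      (∃ x, x ∈ esupp (U 0) ∧ x ∈ esupp (U 1) ∧ x ∈ esupp (U 2)) →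
      (∀ j x, x ∈ esupp (U j) → ¬ ({ω : Set κ | x ∈ ω} ⊆ U j) ∧ ¬ (U j ⊆ {ω : Set κ | x ∈ ω})) →
      (∀ j x, x ∈ esupp (U j) → ∃ j', j' ≠ j ∧ x ∈ esupp (U j')) →
      (∀ j, 5 ≤ (esupp (U j)).card) →
      (¬ (U 1 ∩ U 2 ⊆ U 0) ∧ ¬ (U 0 ∩ U 2 ⊆ U 1) ∧ ¬ (U 0 ∩ U 1 ⊆ U 2)) →
      (∀ (e : κ) (j : Fin 3), e ∈ esupp (U j) →
        thirdCentralMoment (fun X => (prodBernoulli p).real X) (fun i => secAt e true (U i)) < 0 ∧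
        ∀ (T : Finset κ) (i i' : Fin 3), i ≠ i' →
          DeterminedBy (secAt e true (U i)) (↑T : Set κ)ᶜ → ¬ DeterminedBy (secAt e true (U i')) (↑T : Set κ)) →
      0 ≤ sahiE (bernoulliWeight p) 3 (fun j => ind (U j))) :
    MasterFamilyNonneg 3 := by
  refine masterFamilyNonneg_three_of_hardResidualCore (fun κ _ p U hU h1 h2 h3 _ h5 h6 => ?_)
  by_cases hj : ∃ j, (esupp (U j)).card ≤ 4
  · obtain ⟨j, hj⟩ := hj
    exact sahiE_three_nonneg_of_card_esupp_le_four p U hU hj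
  push Not at hj
  exact hres κ p U hU h1 h2 h3 (fun j => by have := hj j; omega) h5 h6

/-- **Kahn's Conjecture 5 ⟺ `C_3` on the hard residual core with members essential on `≥ 5` coordinates.** [this work] -/
theorem masterFamilyNonneg_three_iff_hardResidualCore_five :
    MasterFamilyNonneg 3 ↔
      ∀ (κ : Type) [Fintype κ] (p : κ → unitInterval) (U : Fin 3 → Set (Set κ)), (∀ j, IsUpperSet (U j)) →
        (∃ x, x ∈ esupp (U 0) ∧ x ∈ esupp (U 1) ∧ x ∈ esupp (U 2)) →
        (∀ j x, x ∈ esupp (U j) → ¬ ({ω : Set κ | x ∈ ω} ⊆ U j) ∧ ¬ (U j ⊆ {ω : Set κ | x ∈ ω})) →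
        (∀ j x, x ∈ esupp (U j) → ∃ j', j' ≠ j ∧ x ∈ esupp (U j')) →
        (∀ j, 5 ≤ (esupp (U j)).card) →
        (¬ (U 1 ∩ U 2 ⊆ U 0) ∧ ¬ (U 0 ∩ U 2 ⊆ U 1) ∧ ¬ (U 0 ∩ U 1 ⊆ U 2)) →
        (∀ (e : κ) (j : Fin 3), e ∈ esupp (U j) →
          thirdCentralMoment (fun X => (prodBernoulli p).real X) (fun i => secAt e true (U i)) < 0 ∧
          ∀ (T : Finset κ) (i i' : Fin 3), i ≠ i' →
            DeterminedBy (secAt e true (U i)) (↑T : Set κ)ᶜ → ¬ DeterminedBy (secAt e true (U i')) (↑T : Set κ)) →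
        0 ≤ sahiE (bernoulliWeight p) 3 (fun j => ind (U j)) :=
  ⟨fun h κ _ p U hU _ _ _ _ _ _ => h κ p U hU, masterFamilyNonneg_three_of_hardResidualCore_five⟩

/-- **`KahnConjecture` ⟺ Kahn's inequality on the hard residual core of cubes, members essential on `≥ 5` coordinates.** [this work] -/
theorem kahnConjecture_iff_hardResidualCore_five :
    KahnConjecture ↔
      ∀ (κ : Type) [Fintype κ] (p : κ → unitInterval) (U : Fin 3 → Set (Set κ)), (∀ j, IsUpperSet (U j)) →
        (∃ x, x ∈ esupp (U 0) ∧ x ∈ esupp (U 1) ∧ x ∈ esupp (U 2)) →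
        (∀ j x, x ∈ esupp (U j) → ¬ ({ω : Set κ | x ∈ ω} ⊆ U j) ∧ ¬ (U j ⊆ {ω : Set κ | x ∈ ω})) →
        (∀ j x, x ∈ esupp (U j) → ∃ j', j' ≠ j ∧ x ∈ esupp (U j')) →
        (∀ j, 5 ≤ (esupp (U j)).card) →
        (¬ (U 1 ∩ U 2 ⊆ U 0) ∧ ¬ (U 0 ∩ U 2 ⊆ U 1) ∧ ¬ (U 0 ∩ U 1 ⊆ U 2)) →
        (∀ (e : κ) (j : Fin 3), e ∈ esupp (U j) →
          thirdCentralMoment (fun X => (prodBernoulli p).real X) (fun i => secAt e true (U i)) < 0 ∧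
          ∀ (T : Finset κ) (i i' : Fin 3), i ≠ i' →
            DeterminedBy (secAt e true (U i)) (↑T : Set κ)ᶜ → ¬ DeterminedBy (secAt e true (U i')) (↑T : Set κ)) →
        0 ≤ sahiE (bernoulliWeight p) 3 (fun j => ind (U j)) := by
  rw [← masterFamilyNonneg_three_iff_kahnConjecture]
  exact masterFamilyNonneg_three_iff_hardResidualCore_five

end SahiClassTCube

end Summit.CriticalPhenomena.PercolationContinuityZ3.Theorems
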